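import Literature.Analysis.PDE.DecayBootstrap
import Literature.Analysis.PDE.CutoffCalculus
import Literature.Analysis.FunctionSpaces.MorreyInequality
import Literature.Analysis.FluidPDE.HessianLaplacianLpGeneralProofs
import Mathlib.Analysis.FunctionalSpaces.SobolevInequality
import HarnessLib

/-!
# Pointwise first derivatives from a Laplacian inequality with `L⁶` data on balls of `ℝ³`
# (the `W^{2,6} ⊂ C¹` level of the interior estimates)

Analysis/PDE support file on the discharge path of
`Literature.Geometry.Lorentzian.exists_ricciVariation_negativeMass_of_massZero` (Schoen–Yau 1979,
proof of Thm. 2 via Lemma 3.3 along `ds²_t = ds² + t Ric`). The pointwise derivative estimates of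
Lemma 3.2 ((3.19)–(3.20), "standard interior estimates", Schauder theory in the source) are
obtained in this tree from the flat interior `L²` theory (`InteriorL2Estimates.lean`,
`InteriorSupBound.lean`, `DecayBootstrap.lean`: `H¹`/`H²` energies and `u²`, `(∂u)²`, `(∂²u)²`
pointwise), whose top level (`level_two_ball`) needs **two** derivatives of the source in `L²`.
Along the Ricci variation the source `R_t/8` has only **one** controlled derivative (the metric
`h + t Ric(h)` has three), so the last level must be replaced by an `L⁶` step: a function whose
Laplacian is controlled up to `ε |D²v|` by `L⁶` quantities has its **second** derivatives in `L⁶`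
(Calderón–Zygmund: Stein 1970, Ch. III §1.3 Prop. 3, the tree's
`stein1970_hessian_Lp_bound_holds`), hence its **first** derivatives bounded pointwise (Morrey's
inequality, `p = 6 > 3 = n`, the tree's `morrey_holder`). This file proves that step, at every
scale `σ` with the natural powers of `σ`:

* `opNorm_le_sum_abs_apply` — `‖L‖ ≤ Σᵢ |L(bᵢ)|` for a functional and an orthonormal basis;
* `eLpNorm_restrict_eq_ofReal_of_continuousOn` — on a closed ball, the `L^p` seminorm of a
  continuous function is the real `(∫ |F|^p)^{1/p}`;
* `eLpNorm_six_le_of_ball` — **the Gagliardo–Nirenberg–Sobolev inequality on concentric balls**: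
  `‖F‖_{L⁶(B̄(x₀,σ/2))} ≤ C (‖∇F‖_{L²(B̄(x₀,σ))} + σ⁻¹ ‖F‖_{L²(B̄(x₀,σ))})` for `F` smooth near
  `B̄(x₀,σ)` (Mathlib's `eLpNorm_le_eLpNorm_fderiv_of_eq_inner` for a cut-off product);
* `enorm_fderiv_le_of_laplacian_le_six` — **the main estimate**: there are `ε₁ > 0` and `C` such
  that if `v` is smooth near `B̄(x₀,σ)` and
  `|Δv| ≤ ε √(ΣΣ(∂ₖ∂ₗv)²) + L √(Σ(∂ₖv)²) + L² |v| + G` on `B̄(x₀,σ)` with `ε ≤ ε₁`, then on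
  `B̄(x₀,σ/4)`
  `|∂ⱼv| ≤ C √σ ((L + σ⁻¹) Σₗ ‖∂ₗv‖_{L⁶(B̄)} + (L² + σ⁻²) ‖v‖_{L⁶(B̄)} + ‖G‖_{L⁶(B̄)})`,
  `B̄ = B̄(x₀,σ)` (cut-off `w = ηv`, `‖∂ᵢ∂ⱼw‖₆ ≤ A ‖Δw‖₆` with the `ε`-term absorbed, and
  Morrey's Hölder estimate between a point of `B̄(x₀,σ/4)` and a point off the support of `w`).

Everything is proved; nothing is defined and no named fact is introduced.

## References

* R. Schoen, S.-T. Yau, *On the proof of the positive mass conjecture in general relativity*,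
  Comm. Math. Phys. 65 (1979) 45–76, Lemma 3.2, (3.19)–(3.20), pp. 69–70. [SchoenYauPMT1979]
* D. Gilbarg, N. S. Trudinger, *Elliptic partial differential equations of second order*,
  Springer 2001, Thm. 9.11 (interior `W^{2,p}` estimates), (9.27), Thm. 7.17 (Morrey).
  [GilbargTrudinger2001]
* E. M. Stein, *Singular integrals and differentiability properties of functions* (1970),
  Ch. III §1.3 Prop. 3. [Stein1971]
-/

noncomputable section

set_option maxSynthPendingDepth 3

open MeasureTheory Set Filter Topology Real Metric Bornology Module
open scoped ENNReal NNReal Laplacian ContDiff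

namespace Literature.Analysis.PDE

open Literature.Analysis.FluidPDE Literature.Analysis.FunctionSpaces
open Literature.Geometry.Lorentzian (E3)

/-! ### Helpers -/

section Helpers

/-- A functional on a finite-dimensional inner product space is bounded by the sum of the
absolute values of its values on an orthonormal basis: `‖L‖ ≤ Σᵢ |L(bᵢ)|`. [folklore] -/
theorem opNorm_le_sum_abs_apply {V : Type*} [NormedAddCommGroup V] [InnerProductSpace ℝ V]
    {ι : Type*} [Fintype ι] (b : OrthonormalBasis ι ℝ V) (L : V →L[ℝ] ℝ) :
    ‖L‖ ≤ ∑ i, |L (b i)| := by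
  refine ContinuousLinearMap.opNorm_le_bound _ (Finset.sum_nonneg fun i _ ↦ abs_nonneg _)
    fun v ↦ ?_
  have hv : L v = ∑ i, inner ℝ (b i) v * L (b i) := by
    conv_lhs => rw [← b.sum_repr' v]
    simp [map_sum, map_smul, smul_eq_mul]
  rw [hv, Real.norm_eq_abs, Finset.sum_mul]
  refine (Finset.abs_sum_le_sum_abs _ _).trans (Finset.sum_le_sum fun i _ ↦ ?_)
  rw [abs_mul]
  have h1 : |inner ℝ (b i) v| ≤ ‖v‖ := by
    have h := abs_real_inner_le_norm (b i) v
    rwa [b.orthonormal.1 i, one_mul] at h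
  calc |inner ℝ (b i) v| * |L (b i)| ≤ ‖v‖ * |L (b i)| :=
        mul_le_mul_of_nonneg_right h1 (abs_nonneg _)
    _ = |L (b i)| * ‖v‖ := mul_comm _ _

/-- The sum of absolute values over `Fin 3` is at most `√3` times the Euclidean norm. [folklore] -/
theorem sum_abs_le_sqrt_three_mul_sqrt (x : Fin 3 → ℝ) :
    ∑ i, |x i| ≤ Real.sqrt 3 * Real.sqrt (∑ i, x i ^ 2) := by
  have h1 : (∑ i, |x i|) ^ 2 ≤ 3 * ∑ i, x i ^ 2 := by
    have h := sq_sum_le_card_mul_sum_sq (s := (Finset.univ : Finset (Fin 3))) (f := fun i ↦ |x i|)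
    simp only [Finset.card_univ, Fintype.card_fin, Nat.cast_ofNat, sq_abs] at h
    exact h
  have h2 : 0 ≤ ∑ i, |x i| := Finset.sum_nonneg fun i _ ↦ abs_nonneg _
  rw [← Real.sqrt_mul (by norm_num : (0:ℝ) ≤ 3)]
  exact (Real.le_sqrt h2 (by positivity)).2 h1

/-- The restriction of Lebesgue measure to a closed ball of `ℝ³` is finite. [folklore] -/
theorem isFiniteMeasure_restrict_closedBall (x₀ : E3) (σ : ℝ) :
    IsFiniteMeasure ((volume : Measure E3).restrict (closedBall x₀ σ)) :=
  ⟨by rw [Measure.restrict_apply_univ]; exact measure_closedBall_lt_top⟩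

/-- A function continuous on a closed ball of `ℝ³` is in every `L^p` of the ball. [folklore] -/
theorem memLp_restrict_of_continuousOn {F : E3 → ℝ} {x₀ : E3} {σ : ℝ}
    (hF : ContinuousOn F (closedBall x₀ σ)) (p : ℝ≥0∞) :
    MemLp F p ((volume : Measure E3).restrict (closedBall x₀ σ)) := by
  haveI := isFiniteMeasure_restrict_closedBall x₀ σ
  obtain ⟨C, hC⟩ := (isCompact_closedBall x₀ σ).exists_bound_of_continuousOn hF
  have hm : AEStronglyMeasurable F ((volume : Measure E3).restrict (closedBall x₀ σ)) :=
    hF.aestronglyMeasurable measurableSet_closedBall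
  have htop : MemLp F ⊤ ((volume : Measure E3).restrict (closedBall x₀ σ)) :=
    memLp_top_of_bound hm C ((ae_restrict_iff' measurableSet_closedBall).2 (ae_of_all _ hC))
  exact htop.mono_exponent le_top

/-- **On a closed ball, the `L^p` seminorm of a continuous function is the real integral**
`(∫_{B̄} |F|^p)^{1/p}` (`0 < p < ∞`). [folklore] -/
theorem eLpNorm_restrict_eq_ofReal_of_continuousOn {F : E3 → ℝ} {x₀ : E3} {σ : ℝ}
    (hF : ContinuousOn F (closedBall x₀ σ)) {p : ℝ≥0∞} (hp0 : p ≠ 0) (hptop : p ≠ ⊤) :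
    eLpNorm F p ((volume : Measure E3).restrict (closedBall x₀ σ)) =
      ENNReal.ofReal ((∫ y in closedBall x₀ σ, |F y| ^ p.toReal) ^ p.toReal⁻¹) := by
  rw [(memLp_restrict_of_continuousOn hF p).eLpNorm_eq_integral_rpow_norm hp0 hptop]
  simp only [Real.norm_eq_abs]

/-- The `L²` seminorm on a closed ball of a continuous function as a square root. [folklore] -/
theorem eLpNorm_two_restrict_eq_ofReal_sqrt {F : E3 → ℝ} {x₀ : E3} {σ : ℝ}
    (hF : ContinuousOn F (closedBall x₀ σ)) :
    eLpNorm F 2 ((volume : Measure E3).restrict (closedBall x₀ σ)) =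
      ENNReal.ofReal (Real.sqrt (∫ y in closedBall x₀ σ, F y ^ 2)) := by
  rw [eLpNorm_restrict_eq_ofReal_of_continuousOn hF two_ne_zero ENNReal.ofNat_ne_top]
  congr 1
  rw [Real.sqrt_eq_rpow, ENNReal.toReal_ofNat, one_div]
  congr 1
  refine setIntegral_congr_fun measurableSet_closedBall fun y _ ↦ ?_
  rw [show ((2 : ℝ)) = ((2 : ℕ) : ℝ) by norm_num, Real.rpow_natCast, sq_abs]

/-- Absorption in `ℝ≥0∞`: `x ≤ x/2 + c` and `x < ∞` give `x ≤ 2c`. [folklore] -/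
theorem ENNReal.le_two_mul_of_le_half_add {x c : ℝ≥0∞} (hx : x ≠ ⊤) (h : x ≤ x / 2 + c) :
    x ≤ 2 * c := by
  have h2 : x / 2 ≠ ⊤ := ENNReal.div_ne_top hx two_ne_zero
  have hc : x / 2 + x / 2 = x := ENNReal.add_halves x
  by_cases hct : c = ⊤
  · simp [hct]
  have key : x / 2 ≤ c := by
    have := h
    rw [← hc] at this
    exact (ENNReal.add_le_add_iff_left h2).1 (by simpa [add_comm] using this)
  calc x = x / 2 + x / 2 := hc.symm
    _ ≤ c + c := add_le_add key key
    _ = 2 * c := (two_mul c).symm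

end Helpers

/-! ### The Sobolev inequality `H¹ → L⁶` on concentric balls -/

section GNSBall

/-- **Gagliardo–Nirenberg–Sobolev on concentric balls of `ℝ³`.** There is `C` such that for
every `F` smooth on an open `U ⊇ B̄(x₀,σ)` (`σ > 0`),
`‖F‖_{L⁶(B̄(x₀,σ/2))} ≤ C (‖√(Σᵢ(∂ᵢF)²)‖_{L²(B̄(x₀,σ))} + σ⁻¹ ‖F‖_{L²(B̄(x₀,σ))})`: Mathlib's
inequality `‖w‖₆ ≤ C₀ ‖Dw‖₂` (`eLpNorm_le_eLpNorm_fderiv_of_eq_inner`, `n = 3`, `p = 2`) for the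
cut-off product `w = ηF`, `η = 1` on `B̄(x₀,σ/2)`, `|∂η| ≤ M/σ` (`exists_cutoff_scale`).
[cite: GilbargTrudinger2001, Thm. 7.10 and (7.26)] -/
theorem eLpNorm_six_le_of_ball (b : OrthonormalBasis (Fin 3) ℝ E3) :
    ∃ C : ℝ≥0, ∀ (U : Set E3) (F : E3 → ℝ) (x₀ : E3) (σ : ℝ), IsOpen U →
      closedBall x₀ σ ⊆ U → ContDiffOn ℝ ∞ F U → 0 < σ →
      eLpNorm F 6 ((volume : Measure E3).restrict (closedBall x₀ (σ / 2))) ≤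
        C * ENNReal.ofReal (Real.sqrt (∫ y in closedBall x₀ σ, ∑ i, (fderiv ℝ F y (b i)) ^ 2)
            + σ⁻¹ * Real.sqrt (∫ y in closedBall x₀ σ, F y ^ 2)) := by
  obtain ⟨M, hM1, hcut⟩ := exists_cutoff_scale b
  have hM0 : 0 ≤ M := by linarith
  set C₀ : ℝ≥0 := eLpNormLESNormFDerivOfEqInnerConst (volume : Measure E3) 2 with hC₀
  refine ⟨C₀ * (Real.sqrt 3 + 3 * M).toNNReal, fun U F x₀ σ hU hKU hF hσ ↦ ?_⟩
  obtain ⟨η, hηs, hηc, hηS, hη1, hηabs, hηL, -⟩ := hcut x₀ σ hσ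
  have hηU : tsupport η ⊆ U := hηS.trans hKU
  set w : E3 → ℝ := fun y ↦ η y • F y with hw
  have hws : ContDiff ℝ ∞ w := contDiff_smul_of_tsupport_subset hU hηs hηU hF
  have hwc : HasCompactSupport w := hηc.smul_right
  -- the Gagliardo–Nirenberg–Sobolev inequality for `w`
  have hGNS : eLpNorm w ((6 : ℝ≥0) : ℝ≥0∞) volume ≤
      C₀ * eLpNorm (fderiv ℝ w) ((2 : ℝ≥0) : ℝ≥0∞) volume :=
    eLpNorm_le_eLpNorm_fderiv_of_eq_inner (μ := (volume : Measure E3)) (F' := ℝ)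
      (hws.of_le (by norm_cast)) hwc (p := 2) (p' := 6)
      (by norm_num) (by rw [finrank_euclideanSpace_fin]; norm_num)
      (by rw [finrank_euclideanSpace_fin]; push_cast; norm_num)
  have h6 : ((6 : ℝ≥0) : ℝ≥0∞) = 6 := by norm_cast
  have h2 : ((2 : ℝ≥0) : ℝ≥0∞) = 2 := by norm_cast
  rw [h6, h2] at hGNS
  -- `F` on the half ball is dominated by `w`
  have hlow : eLpNorm F 6 ((volume : Measure E3).restrict (closedBall x₀ (σ / 2))) ≤
      eLpNorm w 6 volume := by
    rw [← eLpNorm_indicator_eq_eLpNorm_restrict measurableSet_closedBall]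
    refine eLpNorm_mono fun y ↦ ?_
    by_cases hy : y ∈ closedBall x₀ (σ / 2)
    · rw [indicator_of_mem hy, hw]
      simp [hη1 y hy]
    · rw [indicator_of_notMem hy, norm_zero]
      exact norm_nonneg _
  -- continuity on the ball
  have hFc : ContinuousOn F (closedBall x₀ σ) := hF.continuousOn.mono hKU
  have hdF : ∀ i, ContinuousOn (fun y ↦ fderiv ℝ F y (b i)) (closedBall x₀ σ) := fun i ↦
    ((hF.continuousOn_fderiv_of_isOpen hU (by simp)).mono hKU).clm_apply continuousOn_const
  set S : E3 → ℝ := fun y ↦ Real.sqrt (∑ i, (fderiv ℝ F y (b i)) ^ 2) with hS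
  have hSc : ContinuousOn S (closedBall x₀ σ) :=
    (continuousOn_finsetSum _ fun i _ ↦ (hdF i).pow 2).sqrt
  -- the gradient of `w` is dominated by `Φ = √3 S + 3 (M/σ) |F|` on the ball
  set Φ : E3 → ℝ := fun y ↦ Real.sqrt 3 * S y + 3 * (M / σ) * |F y| with hΦ
  have hΦ0 : ∀ y, 0 ≤ Φ y := fun y ↦ by
    simp only [hΦ, hS]
    positivity
  have hptw : ∀ y, ‖fderiv ℝ w y‖ ≤ ‖(closedBall x₀ σ).indicator Φ y‖ := by
    intro y
    have hcomp : ∀ i, fderiv ℝ w y (b i) = η y • fderiv ℝ F y (b i) + fderiv ℝ η y (b i) • F y :=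
      fun i ↦ fderiv_smul_of_tsupport_subset_apply hU hηs hηU hF y (b i)
    refine (opNorm_le_sum_abs_apply b (fderiv ℝ w y)).trans ?_
    by_cases hy : y ∈ closedBall x₀ σ
    · rw [indicator_of_mem hy, Real.norm_eq_abs, abs_of_nonneg (hΦ0 y)]
      have hterm : ∀ i, |fderiv ℝ w y (b i)| ≤ |fderiv ℝ F y (b i)| + M / σ * |F y| := by
        intro i
        rw [hcomp i, smul_eq_mul, smul_eq_mul]
        refine (abs_add_le _ _).trans ?_
        rw [abs_mul, abs_mul]
        have t1 : |η y| * |fderiv ℝ F y (b i)| ≤ |fderiv ℝ F y (b i)| := by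
          have := hηabs y
          nlinarith [abs_nonneg (fderiv ℝ F y (b i))]
        have t2 : |fderiv ℝ η y (b i)| * |F y| ≤ M / σ * |F y| :=
          mul_le_mul_of_nonneg_right (hηL y i) (abs_nonneg _)
        linarith
      calc ∑ i, |fderiv ℝ w y (b i)| ≤ ∑ i, (|fderiv ℝ F y (b i)| + M / σ * |F y|) :=
            Finset.sum_le_sum fun i _ ↦ hterm i
        _ = ∑ i, |fderiv ℝ F y (b i)| + 3 * (M / σ) * |F y| := by
            rw [Finset.sum_add_distrib, Finset.sum_const, Finset.card_univ, Fintype.card_fin]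
            simp only [nsmul_eq_mul, Nat.cast_ofNat]
            ring
        _ ≤ Real.sqrt 3 * S y + 3 * (M / σ) * |F y| := by
            have := sum_abs_le_sqrt_three_mul_sqrt fun i ↦ fderiv ℝ F y (b i)
            simp only [hS]
            linarith
    · have hy' : y ∉ tsupport η := fun h ↦ hy (hηS h)
      obtain ⟨h0, h1⟩ := eq_zero_of_notMem_tsupport η hy'
      rw [indicator_of_notMem hy, norm_zero]
      refine (Finset.sum_nonpos fun i _ ↦ ?_)
      rw [hcomp i, h0, h1]
      simp
  have hup : eLpNorm (fderiv ℝ w) 2 volume ≤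
      eLpNorm Φ 2 ((volume : Measure E3).restrict (closedBall x₀ σ)) := by
    rw [← eLpNorm_indicator_eq_eLpNorm_restrict measurableSet_closedBall]
    exact eLpNorm_mono hptw
  -- split `Φ`
  set μ : Measure E3 := (volume : Measure E3).restrict (closedBall x₀ σ) with hμ
  have hSm : AEStronglyMeasurable S μ := hSc.aestronglyMeasurable measurableSet_closedBall
  have hFm : AEStronglyMeasurable (fun y ↦ |F y|) μ :=
    (continuous_abs.comp_continuousOn hFc).aestronglyMeasurable measurableSet_closedBall
  have hΦsplit : eLpNorm Φ 2 μ ≤ ENNReal.ofReal (Real.sqrt 3) * eLpNorm S 2 μ +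
      ENNReal.ofReal (3 * (M / σ)) * eLpNorm F 2 μ := by
    have h1 : eLpNorm (fun y ↦ Real.sqrt 3 * S y) 2 μ = ENNReal.ofReal (Real.sqrt 3) * eLpNorm S 2 μ := by
      rw [show (fun y ↦ Real.sqrt 3 * S y) = Real.sqrt 3 • S from rfl, eLpNorm_const_smul,
        Real.enorm_eq_ofReal (Real.sqrt_nonneg _)]
    have h2 : eLpNorm (fun y ↦ 3 * (M / σ) * |F y|) 2 μ =
        ENNReal.ofReal (3 * (M / σ)) * eLpNorm F 2 μ := by
      rw [show (fun y ↦ 3 * (M / σ) * |F y|) = (3 * (M / σ)) • fun y ↦ |F y| from rfl,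
        eLpNorm_const_smul, Real.enorm_eq_ofReal (by positivity)]
      congr 1
      exact eLpNorm_congr_norm_ae (ae_of_all _ fun y ↦ by simp)
    calc eLpNorm Φ 2 μ = eLpNorm ((fun y ↦ Real.sqrt 3 * S y) + fun y ↦ 3 * (M / σ) * |F y|) 2 μ := by
          rfl
      _ ≤ eLpNorm (fun y ↦ Real.sqrt 3 * S y) 2 μ + eLpNorm (fun y ↦ 3 * (M / σ) * |F y|) 2 μ :=
          eLpNorm_add_le (hSm.const_mul _) (hFm.const_mul _) (by norm_num)
      _ = _ := by rw [h1, h2]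
  -- the two `L²` seminorms as real integrals
  have hS2 : eLpNorm S 2 μ =
      ENNReal.ofReal (Real.sqrt (∫ y in closedBall x₀ σ, ∑ i, (fderiv ℝ F y (b i)) ^ 2)) := by
    rw [hμ, eLpNorm_two_restrict_eq_ofReal_sqrt hSc]
    congr 2
    refine setIntegral_congr_fun measurableSet_closedBall fun y _ ↦ ?_
    simp only [hS]
    rw [Real.sq_sqrt (Finset.sum_nonneg fun i _ ↦ sq_nonneg _)]
  have hF2 : eLpNorm F 2 μ = ENNReal.ofReal (Real.sqrt (∫ y in closedBall x₀ σ, F y ^ 2)) := by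
    rw [hμ, eLpNorm_two_restrict_eq_ofReal_sqrt hFc]
  -- assemble
  set a : ℝ := Real.sqrt (∫ y in closedBall x₀ σ, ∑ i, (fderiv ℝ F y (b i)) ^ 2) with ha
  set a₀ : ℝ := Real.sqrt (∫ y in closedBall x₀ σ, F y ^ 2) with ha₀
  have ha0 : 0 ≤ a := Real.sqrt_nonneg _
  have ha₀0 : 0 ≤ a₀ := Real.sqrt_nonneg _
  have hreal : ENNReal.ofReal (Real.sqrt 3) * ENNReal.ofReal a +
      ENNReal.ofReal (3 * (M / σ)) * ENNReal.ofReal a₀ ≤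
      ENNReal.ofReal (Real.sqrt 3 + 3 * M) * ENNReal.ofReal (a + σ⁻¹ * a₀) := by
    rw [← ENNReal.ofReal_mul (Real.sqrt_nonneg _), ← ENNReal.ofReal_mul (by positivity),
      ← ENNReal.ofReal_add (by positivity) (by positivity), ← ENNReal.ofReal_mul (by positivity)]
    refine ENNReal.ofReal_le_ofReal ?_
    have hσinv : 0 ≤ σ⁻¹ := inv_nonneg.2 hσ.le
    have : 3 * (M / σ) * a₀ = 3 * M * (σ⁻¹ * a₀) := by rw [div_eq_mul_inv]; ring
    rw [this]
    nlinarith [Real.sqrt_nonneg 3, mul_nonneg hM0 ha0, mul_nonneg (Real.sqrt_nonneg 3) (mul_nonneg hσinv ha₀0)]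
  calc eLpNorm F 6 ((volume : Measure E3).restrict (closedBall x₀ (σ / 2)))
      ≤ eLpNorm w 6 volume := hlow
    _ ≤ C₀ * eLpNorm (fderiv ℝ w) 2 volume := hGNS
    _ ≤ C₀ * eLpNorm Φ 2 μ := by gcongr
    _ ≤ C₀ * (ENNReal.ofReal (Real.sqrt 3) * eLpNorm S 2 μ +
          ENNReal.ofReal (3 * (M / σ)) * eLpNorm F 2 μ) := by gcongr
    _ = C₀ * (ENNReal.ofReal (Real.sqrt 3) * ENNReal.ofReal a +
          ENNReal.ofReal (3 * (M / σ)) * ENNReal.ofReal a₀) := by rw [hS2, hF2]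
    _ ≤ C₀ * (ENNReal.ofReal (Real.sqrt 3 + 3 * M) * ENNReal.ofReal (a + σ⁻¹ * a₀)) := by
        gcongr
    _ = ((C₀ * (Real.sqrt 3 + 3 * M).toNNReal : ℝ≥0) : ℝ≥0∞) * ENNReal.ofReal (a + σ⁻¹ * a₀) := by
        rw [ENNReal.coe_mul, mul_assoc]
        rfl

end GNSBall

/-! ### The main estimate -/

section Main

/-- `√(Σₖ xₖ²) ≤ Σₖ |xₖ|`. [folklore] -/
theorem sqrt_sum_sq_le_sum_abs {κ : Type*} [Fintype κ] (x : κ → ℝ) :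
    Real.sqrt (∑ k, x k ^ 2) ≤ ∑ k, |x k| := by
  have h0 : 0 ≤ ∑ k, |x k| := Finset.sum_nonneg fun k _ ↦ abs_nonneg _
  refine Real.sqrt_le_iff.2 ⟨h0, ?_⟩
  calc ∑ k, x k ^ 2 = ∑ k, |x k| ^ 2 := Finset.sum_congr rfl fun k _ ↦ (sq_abs _).symm
    _ ≤ (∑ k, |x k|) ^ 2 := Finset.sum_sq_le_sq_sum_of_nonneg fun k _ ↦ abs_nonneg _

/-- `√(Σₖₗ xₖₗ²) ≤ Σₖₗ |xₖₗ|`. [folklore] -/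
theorem sqrt_sum_sum_sq_le_sum_sum_abs {κ : Type*} [Fintype κ] (x : κ → κ → ℝ) :
    Real.sqrt (∑ k, ∑ l, x k l ^ 2) ≤ ∑ k, ∑ l, |x k l| := by
  have h := sqrt_sum_sq_le_sum_abs (fun q : κ × κ ↦ x q.1 q.2)
  simp only [Fintype.sum_prod_type] at h
  exact h

set_option maxHeartbeats 800000 in
/-- **Pointwise first derivatives from a Laplacian inequality with `L⁶` data** (the
`W^{2,6} ⊂ C¹` level of the interior estimates on balls of `ℝ³`). There are `ε₁ > 0` and `C`
such that: if `v` is smooth on an open `U ⊇ B̄(x₀,σ)` (`σ > 0`), `G` is continuous on the ball,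
`0 ≤ ε ≤ ε₁`, `0 ≤ L`, and on `B̄(x₀,σ)`
`|Δv| ≤ ε √(ΣΣ(∂ₗ∂ₖv)²) + L √(Σ(∂ₖv)²) + L² |v| + G`, then for `x ∈ B̄(x₀,σ/4)` and every `j`

  `|∂ⱼv(x)| ≤ C √σ ((L + σ⁻¹) Σₗ ‖∂ₗv‖_{L⁶(B̄)} + (L² + σ⁻²) ‖v‖_{L⁶(B̄)} + ‖G‖_{L⁶(B̄)})`,

`B̄ = B̄(x₀,σ)` (in `ℝ≥0∞`, with `eLpNorm` over the restricted Lebesgue measure). Proof: for the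
cut-off product `w = ηv` (`η = 1` on `B̄(x₀,σ/2)`, `|∂η| ≤ M/σ`, `|∂²η| ≤ (M/σ)²`),
`|Δw| ≤ ε ΣΣ|∂ₗ∂ₖw| + Ψ` with `Ψ` an `L⁶` combination of `∂v, v, G` on the ball; the
Calderón–Zygmund inequality `‖∂ₗ∂ₖw‖₆ ≤ A ‖Δw‖₆` (`stein1970_hessian_Lp_bound_holds`) absorbs
the `ε`-term for `18 A ε ≤ 1`, and Morrey's Hölder estimate (`morrey_holder`, `p = 6 > 3`)
between `x` and a point at distance `2σ` from `x₀` (where `∂ⱼw = 0`) bounds `∂ⱼw(x) = ∂ⱼv(x)`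
by `C ‖D∂ⱼw‖₆ (3σ)^{1/2}`. This replaces the Schauder estimate (3.19)–(3.20) of Schoen–Yau at
the top level when the source has one derivative only.
[cite: GilbargTrudinger2001, Thm. 9.11 with (9.27), and Thm. 7.17] -/
theorem enorm_fderiv_le_of_laplacian_le_six (b : OrthonormalBasis (Fin 3) ℝ E3) :
    ∃ ε₁ C : ℝ, 0 < ε₁ ∧ 0 ≤ C ∧ ∀ (U : Set E3) (v G : E3 → ℝ) (x₀ : E3) (σ ε L : ℝ),
      IsOpen U → closedBall x₀ σ ⊆ U → ContDiffOn ℝ ∞ v U → 0 < σ → 0 ≤ ε → ε ≤ ε₁ → 0 ≤ L →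
      ContinuousOn G (closedBall x₀ σ) →
      (∀ x ∈ closedBall x₀ σ, |(Δ v) x| ≤
        ε * Real.sqrt (∑ k, ∑ l, (fderiv ℝ (fun y => fderiv ℝ v y (b k)) x (b l)) ^ 2)
          + L * Real.sqrt (∑ k, (fderiv ℝ v x (b k)) ^ 2) + L ^ 2 * |v x| + G x) →
      ∀ x ∈ closedBall x₀ (σ / 4), ∀ j,
        ‖fderiv ℝ v x (b j)‖ₑ ≤ ENNReal.ofReal (C * Real.sqrt σ) *
          (ENNReal.ofReal (L + σ⁻¹) *
              ∑ l, eLpNorm (fun y ↦ fderiv ℝ v y (b l)) 6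
                ((volume : Measure E3).restrict (closedBall x₀ σ))
            + ENNReal.ofReal (L ^ 2 + σ⁻¹ ^ 2) *
                eLpNorm v 6 ((volume : Measure E3).restrict (closedBall x₀ σ))
            + eLpNorm G 6 ((volume : Measure E3).restrict (closedBall x₀ σ))) := by
  -- the three analytic constants
  obtain ⟨A, hA⟩ := stein1970_hessian_Lp_bound_holds (E := E3) 6 (by norm_num) (by simp)
  obtain ⟨CM, hCMtop, hMor⟩ := morrey_holder (volume : Measure E3) (F := ℝ) (p := 6)
    (by norm_num) (by rw [finrank_euclideanSpace_fin]; norm_num)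
  obtain ⟨M, hM1, hcut⟩ := exists_cutoff_scale b
  have hM0 : 0 ≤ M := by linarith
  have hexp : (1 - (finrank ℝ E3 : ℝ) / ((6 : ℝ≥0) : ℝ)) = 1 / 2 := by
    rw [finrank_euclideanSpace_fin]; push_cast; norm_num
  rw [hexp] at hMor
  have h6 : ((6 : ℝ≥0) : ℝ≥0∞) = 6 := by norm_cast
  rw [h6] at hMor
  -- the constants of the statement
  set ε₁ : ℝ := 1 / (18 * ((A : ℝ) + 1)) with hε₁
  have hA0 : 0 ≤ (A : ℝ) := A.2
  have hε₁0 : 0 < ε₁ := by rw [hε₁]; positivity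
  set C : ℝ := CM.toReal * Real.sqrt 3 * (6 * A) * (12 * M ^ 2) with hC
  have hC0 : 0 ≤ C := by rw [hC]; positivity
  refine ⟨ε₁, C, hε₁0, hC0, fun U v G x₀ σ ε L hU hKU hv hσ hε0 hε hL hG hΔ x hx j ↦ ?_⟩
  have hε1 : ε ≤ 1 := by
    refine hε.trans ?_
    rw [hε₁, div_le_one (by positivity)]
    nlinarith
  -- the cut-off and the product `w = η v`
  obtain ⟨η, hηs, hηc, hηS, hη1, hηabs, hηL, hηL2⟩ := hcut x₀ σ hσ
  have hηU : tsupport η ⊆ U := hηS.trans hKU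
  set w : E3 → ℝ := fun y ↦ η y • v y with hw
  have hws : ContDiff ℝ ∞ w := contDiff_smul_of_tsupport_subset hU hηs hηU hv
  have hw2 : ContDiff ℝ 2 w := hws.of_le (by norm_cast)
  have hwc : HasCompactSupport w := hηc.smul_right
  -- notation for the partial derivatives
  set D1v : E3 → Fin 3 → ℝ := fun y k ↦ fderiv ℝ v y (b k) with hD1v
  set D2v : E3 → Fin 3 → Fin 3 → ℝ := fun y k l ↦ fderiv ℝ (fun z ↦ fderiv ℝ v z (b k)) y (b l)
    with hD2v
  set D2w : E3 → Fin 3 → Fin 3 → ℝ := fun y k l ↦ fderiv ℝ (fun z ↦ fderiv ℝ w z (b k)) y (b l)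
    with hD2w
  -- first derivatives of `w`
  have hD1w : ∀ y k, fderiv ℝ w y (b k) = η y * D1v y k + fderiv ℝ η y (b k) * v y := by
    intro y k
    have h := fderiv_smul_of_tsupport_subset_apply hU hηs hηU hv y (b k)
    simpa only [smul_eq_mul, hw, hD1v] using h
  -- second derivatives of `w`
  have hD2w_eq : ∀ y k l, D2w y k l = η y * D2v y k l + fderiv ℝ η y (b l) * D1v y k +
      fderiv ℝ η y (b k) * D1v y l + fderiv ℝ (fun z ↦ fderiv ℝ η z (b k)) y (b l) * v y := by
    intro y k l
    have h := fderiv_fderiv_smul_of_tsupport_subset_apply hU hηs hηU hv y (b l) (b k)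
    simpa only [smul_eq_mul, hw, hD2w, hD2v, hD1v] using h
  -- off the support everything vanishes
  have hoff' : ∀ y ∉ tsupport η, (∀ k, fderiv ℝ w y (b k) = 0) ∧ ∀ k l, D2w y k l = 0 := by
    intro y hy'
    refine ⟨fun k ↦ ?_, fun k l ↦ ?_⟩
    · obtain ⟨h0, h1, -⟩ := eq_zero_of_notMem_tsupport_cutoff (η := η) hy' (b k) (b k)
      rw [hD1w, h0, h1]; ring
    · obtain ⟨h0, h1l, -⟩ := eq_zero_of_notMem_tsupport_cutoff (η := η) hy' (b l) (b k)
      obtain ⟨-, h1k, h2⟩ := eq_zero_of_notMem_tsupport_cutoff (η := η) hy' (b k) (b l)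
      rw [hD2w_eq, h0, h1l, h1k, h2]; ring
  have hoff : ∀ y ∉ closedBall x₀ σ, (∀ k, fderiv ℝ w y (b k) = 0) ∧ ∀ k l, D2w y k l = 0 :=
    fun y hy ↦ hoff' y fun h ↦ hy (hηS h)
  -- the Laplacian of `w` pointwise
  have hΔw_sum : ∀ y, (Δ w) y = ∑ k, D2w y k k := fun y ↦
    laplacian_eq_sum_of_contDiffAt b hw2.contDiffAt
  -- the pointwise Laplacian inequality for `w`
  set Ψ : E3 → ℝ := fun y ↦ (L + 8 * (M / σ)) * ∑ k, |D1v y k| +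
      (L ^ 2 + 12 * (M / σ) ^ 2) * |v y| + |G y| with hΨ
  have hΨ0 : ∀ y, 0 ≤ Ψ y := fun y ↦ by
    simp only [hΨ]
    have : 0 ≤ ∑ k, |D1v y k| := Finset.sum_nonneg fun k _ ↦ abs_nonneg _
    positivity
  have hΔw_le : ∀ y, |(Δ w) y| ≤ ε * ∑ k, ∑ l, |D2w y k l| + (closedBall x₀ σ).indicator Ψ y := by
    intro y
    by_cases hy : y ∈ closedBall x₀ σ
    · rw [indicator_of_mem hy]
      have hyU : y ∈ U := hKU hy
      have hvy : ContDiffAt ℝ 2 v y :=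
        (hv.contDiffAt (hU.mem_nhds hyU)).of_le (by norm_cast)
      have hΔv_sum : (Δ v) y = ∑ k, D2v y k k := laplacian_eq_sum_of_contDiffAt b hvy
      -- `Δw = η Δv + 2 Σ ∂η ∂v + (Σ ∂∂η) v`
      have hΔw_exp : (Δ w) y = η y * (Δ v) y + 2 * ∑ k, fderiv ℝ η y (b k) * D1v y k +
          (∑ k, fderiv ℝ (fun z ↦ fderiv ℝ η z (b k)) y (b k)) * v y := by
        rw [hΔw_sum, hΔv_sum, Finset.mul_sum, Finset.mul_sum, Finset.sum_mul,
          ← Finset.sum_add_distrib, ← Finset.sum_add_distrib]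
        refine Finset.sum_congr rfl fun k _ ↦ ?_
        rw [hD2w_eq]; ring
      -- the `η ∂∂v` entries through `∂∂w`
      have hηD2 : ∀ k l, |η y * D2v y k l| ≤
          |D2w y k l| + M / σ * (|D1v y k| + |D1v y l|) + (M / σ) ^ 2 * |v y| := by
        intro k l
        have heq : η y * D2v y k l = D2w y k l - (fderiv ℝ η y (b l) * D1v y k +
            fderiv ℝ η y (b k) * D1v y l + fderiv ℝ (fun z ↦ fderiv ℝ η z (b k)) y (b l) * v y) := by
          rw [hD2w_eq]; ring
        rw [heq]
        refine (abs_sub _ _).trans ?_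
        have t1 : |fderiv ℝ η y (b l) * D1v y k| ≤ M / σ * |D1v y k| := by
          rw [abs_mul]; exact mul_le_mul_of_nonneg_right (hηL y l) (abs_nonneg _)
        have t2 : |fderiv ℝ η y (b k) * D1v y l| ≤ M / σ * |D1v y l| := by
          rw [abs_mul]; exact mul_le_mul_of_nonneg_right (hηL y k) (abs_nonneg _)
        have t3 : |fderiv ℝ (fun z ↦ fderiv ℝ η z (b k)) y (b l) * v y| ≤ (M / σ) ^ 2 * |v y| := by
          rw [abs_mul]; exact mul_le_mul_of_nonneg_right (hηL2 y k l) (abs_nonneg _)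
        have := abs_add_three (fderiv ℝ η y (b l) * D1v y k) (fderiv ℝ η y (b k) * D1v y l)
          (fderiv ℝ (fun z ↦ fderiv ℝ η z (b k)) y (b l) * v y)
        linarith
      have hsumηD2 : ∑ k, ∑ l, |η y * D2v y k l| ≤
          ∑ k, ∑ l, |D2w y k l| + 6 * (M / σ) * ∑ k, |D1v y k| + 9 * (M / σ) ^ 2 * |v y| := by
        calc ∑ k, ∑ l, |η y * D2v y k l|
            ≤ ∑ k, ∑ l, (|D2w y k l| + M / σ * (|D1v y k| + |D1v y l|) + (M / σ) ^ 2 * |v y|) :=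
              Finset.sum_le_sum fun k _ ↦ Finset.sum_le_sum fun l _ ↦ hηD2 k l
          _ = ∑ k, ∑ l, |D2w y k l| + 6 * (M / σ) * ∑ k, |D1v y k| + 9 * (M / σ) ^ 2 * |v y| := by
              simp only [Finset.sum_add_distrib, Finset.sum_const, Finset.card_univ,
                Fintype.card_fin, nsmul_eq_mul, Nat.cast_ofNat, ← Finset.mul_sum,
                mul_add, Fin.sum_univ_three]
              ring
      -- the `ε`-term
      have hR2 : Real.sqrt (∑ k, ∑ l, D2v y k l ^ 2) ≤ ∑ k, ∑ l, |D2v y k l| :=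
        sqrt_sum_sum_sq_le_sum_sum_abs _
      have hR1 : Real.sqrt (∑ k, D1v y k ^ 2) ≤ ∑ k, |D1v y k| := sqrt_sum_sq_le_sum_abs _
      have hηabs' : |η y| ≤ 1 := hηabs y
      have hη0 : 0 ≤ |η y| := abs_nonneg _
      have hS1 : 0 ≤ ∑ k, |D1v y k| := Finset.sum_nonneg fun k _ ↦ abs_nonneg _
      have hS2η : ∑ k, ∑ l, |η y * D2v y k l| = |η y| * ∑ k, ∑ l, |D2v y k l| := by
        rw [Finset.mul_sum]
        refine Finset.sum_congr rfl fun k _ ↦ ?_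
        rw [Finset.mul_sum]
        refine Finset.sum_congr rfl fun l _ ↦ ?_
        rw [abs_mul]
      -- main pointwise computation
      have hmain := hΔ y hy
      have hterm1 : |η y * (Δ v) y| ≤ ε * ∑ k, ∑ l, |D2w y k l| +
          (6 * (M / σ) + L) * ∑ k, |D1v y k| + (9 * (M / σ) ^ 2 + L ^ 2) * |v y| + |G y| := by
        rw [abs_mul]
        have h1 : |η y| * |(Δ v) y| ≤ |η y| * (ε * Real.sqrt (∑ k, ∑ l, D2v y k l ^ 2)
            + L * Real.sqrt (∑ k, D1v y k ^ 2) + L ^ 2 * |v y| + G y) :=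
          mul_le_mul_of_nonneg_left hmain hη0
        have h2 : |η y| * (ε * Real.sqrt (∑ k, ∑ l, D2v y k l ^ 2)) ≤
            ε * (∑ k, ∑ l, |D2w y k l| + 6 * (M / σ) * ∑ k, |D1v y k| + 9 * (M / σ) ^ 2 * |v y|) := by
          calc |η y| * (ε * Real.sqrt (∑ k, ∑ l, D2v y k l ^ 2))
              ≤ |η y| * (ε * ∑ k, ∑ l, |D2v y k l|) := by gcongr
            _ = ε * ∑ k, ∑ l, |η y * D2v y k l| := by rw [hS2η]; ring
            _ ≤ _ := mul_le_mul_of_nonneg_left hsumηD2 hε0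
        have h3 : |η y| * (L * Real.sqrt (∑ k, D1v y k ^ 2)) ≤ L * ∑ k, |D1v y k| := by
          calc |η y| * (L * Real.sqrt (∑ k, D1v y k ^ 2)) ≤ 1 * (L * ∑ k, |D1v y k|) := by gcongr
            _ = _ := one_mul _
        have h4 : |η y| * (L ^ 2 * |v y|) ≤ L ^ 2 * |v y| := by
          calc |η y| * (L ^ 2 * |v y|) ≤ 1 * (L ^ 2 * |v y|) := by gcongr
            _ = _ := one_mul _
        have h5 : |η y| * G y ≤ |G y| := by
          calc |η y| * G y ≤ |η y| * |G y| := mul_le_mul_of_nonneg_left (le_abs_self _) hη0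
            _ ≤ 1 * |G y| := by gcongr
            _ = _ := one_mul _
        have hε6 : ε * (6 * (M / σ) * ∑ k, |D1v y k|) ≤ 6 * (M / σ) * ∑ k, |D1v y k| := by
          have : 0 ≤ 6 * (M / σ) * ∑ k, |D1v y k| := by positivity
          nlinarith
        have hε9 : ε * (9 * (M / σ) ^ 2 * |v y|) ≤ 9 * (M / σ) ^ 2 * |v y| := by
          have : 0 ≤ 9 * (M / σ) ^ 2 * |v y| := by positivity
          nlinarith
        linarith [h1, h2, h3, h4, h5, hε6, hε9]
      have hterm2 : |2 * ∑ k, fderiv ℝ η y (b k) * D1v y k| ≤ 2 * (M / σ) * ∑ k, |D1v y k| := by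
        rw [abs_mul, abs_two, mul_assoc, Finset.mul_sum (s := Finset.univ) (a := M / σ)]
        refine mul_le_mul_of_nonneg_left ((Finset.abs_sum_le_sum_abs _ _).trans
          (Finset.sum_le_sum fun k _ ↦ ?_)) zero_le_two
        rw [abs_mul]
        exact mul_le_mul_of_nonneg_right (hηL y k) (abs_nonneg _)
      have hterm3 : |(∑ k, fderiv ℝ (fun z ↦ fderiv ℝ η z (b k)) y (b k)) * v y| ≤
          3 * (M / σ) ^ 2 * |v y| := by
        rw [abs_mul]
        refine mul_le_mul_of_nonneg_right ?_ (abs_nonneg _)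
        calc |∑ k, fderiv ℝ (fun z ↦ fderiv ℝ η z (b k)) y (b k)|
            ≤ ∑ k, |fderiv ℝ (fun z ↦ fderiv ℝ η z (b k)) y (b k)| := Finset.abs_sum_le_sum_abs _ _
          _ ≤ ∑ _k : Fin 3, (M / σ) ^ 2 := Finset.sum_le_sum fun k _ ↦ hηL2 y k k
          _ = 3 * (M / σ) ^ 2 := by simp
      rw [hΔw_exp]
      have habs3 := abs_add_three (η y * (Δ v) y) (2 * ∑ k, fderiv ℝ η y (b k) * D1v y k)
        ((∑ k, fderiv ℝ (fun z ↦ fderiv ℝ η z (b k)) y (b k)) * v y)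
      simp only [hΨ]
      linarith [hterm1, hterm2, hterm3, habs3]
    · rw [indicator_of_notMem hy, hΔw_sum]
      obtain ⟨-, h2⟩ := hoff y hy
      simp only [h2, Finset.sum_const_zero, abs_zero, add_zero]
      positivity
  /- ───── the `L⁶` part ───── -/
  set μ : Measure E3 := (volume : Measure E3).restrict (closedBall x₀ σ) with hμ
  -- continuity and support of the derivatives of `w`
  have hD2wc : ∀ k l, Continuous fun y ↦ D2w y k l := fun k l ↦
    continuous_fderiv_fderiv_apply hw2 (b k) (b l)
  have hΔwc : Continuous (Δ w) := continuous_laplacian hw2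
  have hΔw0 : ∀ y ∉ tsupport η, (Δ w) y = 0 := fun y hy ↦ by
    rw [hΔw_sum]
    simp [(hoff' y hy).2]
  have hΔw_cs : HasCompactSupport (Δ w) := HasCompactSupport.intro hηc hΔw0
  have hΔw_fin : eLpNorm (Δ w) 6 volume ≠ ⊤ :=
    (hΔwc.memLp_of_hasCompactSupport (p := 6) hΔw_cs).eLpNorm_ne_top
  have hD2wm : ∀ k l, AEStronglyMeasurable (fun y ↦ D2w y k l) volume := fun k l ↦
    (hD2wc k l).aestronglyMeasurable
  -- Calderón–Zygmund for each pair of directions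
  have hnb : ∀ i, ‖b i‖ ≤ 1 := fun i ↦ (b.orthonormal.1 i).le
  have hCZ : ∀ k l, eLpNorm (fun y ↦ D2w y k l) 6 volume ≤ A * eLpNorm (Δ w) 6 volume :=
    fun k l ↦ hA w hw2 hwc (b k) (b l) (hnb k) (hnb l)
  -- the indicator of `Ψ`
  have hD1vc : ∀ k, ContinuousOn (fun y ↦ D1v y k) (closedBall x₀ σ) := fun k ↦
    ((hv.continuousOn_fderiv_of_isOpen hU (by simp)).mono hKU).clm_apply continuousOn_const
  have hvc : ContinuousOn v (closedBall x₀ σ) := hv.continuousOn.mono hKU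
  have hΨc : ContinuousOn Ψ (closedBall x₀ σ) := by
    simp only [hΨ]
    exact ((continuousOn_const.mul (continuousOn_finsetSum _ fun k _ ↦
      (continuous_abs.comp_continuousOn (hD1vc k)))).add
      (continuousOn_const.mul (continuous_abs.comp_continuousOn hvc))).add
      (continuous_abs.comp_continuousOn hG)
  have hΨm : AEStronglyMeasurable Ψ μ := hΨc.aestronglyMeasurable measurableSet_closedBall
  have hΨim : AEStronglyMeasurable ((closedBall x₀ σ).indicator Ψ) volume :=
    (aestronglyMeasurable_indicator_iff measurableSet_closedBall).2 hΨm
  -- `‖Δw‖₆ ≤ ε ΣΣ ‖∂∂w‖₆ + ‖1_B Ψ‖₆`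
  have hT : eLpNorm (Δ w) 6 volume ≤
      ENNReal.ofReal ε * ∑ k, ∑ l, eLpNorm (fun y ↦ D2w y k l) 6 volume +
        eLpNorm ((closedBall x₀ σ).indicator Ψ) 6 volume := by
    obtain ⟨T, hTdef⟩ : ∃ T : E3 → ℝ, T = fun y ↦ ε * ∑ k, ∑ l, |D2w y k l| := ⟨_, rfl⟩
    have hT0 : ∀ y, 0 ≤ T y := fun y ↦ by
      rw [hTdef]
      exact mul_nonneg hε0 (Finset.sum_nonneg fun k _ ↦ Finset.sum_nonneg fun l _ ↦ abs_nonneg _)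
    have hpt : ∀ y, ‖(Δ w) y‖ ≤ ‖(T + (closedBall x₀ σ).indicator Ψ) y‖ := by
      intro y
      have hind : 0 ≤ (closedBall x₀ σ).indicator Ψ y :=
        Set.indicator_nonneg (fun z _ ↦ hΨ0 z) y
      rw [Pi.add_apply, Real.norm_eq_abs, Real.norm_eq_abs, abs_of_nonneg (add_nonneg (hT0 y) hind),
        hTdef]
      exact hΔw_le y
    have hTc : Continuous T := by
      rw [hTdef]
      exact continuous_const.mul (continuous_finsetSum _ fun k _ ↦
        continuous_finsetSum _ fun l _ ↦ continuous_abs.comp (hD2wc k l))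
    have hm1 : ∀ k l, AEStronglyMeasurable (fun y ↦ ε * |D2w y k l|) volume := fun k l ↦
      (continuous_const.mul (continuous_abs.comp (hD2wc k l))).aestronglyMeasurable
    have hTsum : eLpNorm T 6 volume = eLpNorm (∑ k, ∑ l, fun y ↦ ε * |D2w y k l|) 6 volume := by
      congr 1
      funext y
      simp only [hTdef, Finset.sum_apply, Finset.mul_sum]
    calc eLpNorm (Δ w) 6 volume
        ≤ eLpNorm (T + (closedBall x₀ σ).indicator Ψ) 6 volume := eLpNorm_mono hpt
      _ ≤ eLpNorm T 6 volume + eLpNorm ((closedBall x₀ σ).indicator Ψ) 6 volume :=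
          eLpNorm_add_le hTc.aestronglyMeasurable hΨim (by norm_num)
      _ = eLpNorm (∑ k, ∑ l, fun y ↦ ε * |D2w y k l|) 6 volume +
            eLpNorm ((closedBall x₀ σ).indicator Ψ) 6 volume := by rw [hTsum]
      _ ≤ (∑ k, eLpNorm (∑ l, fun y ↦ ε * |D2w y k l|) 6 volume) +
            eLpNorm ((closedBall x₀ σ).indicator Ψ) 6 volume := by
          gcongr
          exact eLpNorm_sum_le (fun k _ ↦ Finset.aestronglyMeasurable_sum _ fun l _ ↦ hm1 k l)
            (by norm_num)
      _ ≤ (∑ k, ∑ l, eLpNorm (fun y ↦ ε * |D2w y k l|) 6 volume) +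
            eLpNorm ((closedBall x₀ σ).indicator Ψ) 6 volume := by
          gcongr with k
          exact eLpNorm_sum_le (fun l _ ↦ hm1 k l) (by norm_num)
      _ = ENNReal.ofReal ε * ∑ k, ∑ l, eLpNorm (fun y ↦ D2w y k l) 6 volume +
            eLpNorm ((closedBall x₀ σ).indicator Ψ) 6 volume := by
          congr 1
          rw [Finset.mul_sum]
          refine Finset.sum_congr rfl fun k _ ↦ ?_
          rw [Finset.mul_sum]
          refine Finset.sum_congr rfl fun l _ ↦ ?_
          rw [show (fun y ↦ ε * |D2w y k l|) = ε • fun y ↦ |D2w y k l| from rfl,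
            eLpNorm_const_smul, Real.enorm_eq_ofReal hε0]
          congr 1
          exact eLpNorm_congr_norm_ae (ae_of_all _ fun y ↦ by simp)
  -- absorb the Calderón–Zygmund term
  have hΔw_bd : eLpNorm (Δ w) 6 volume ≤ 2 * eLpNorm ((closedBall x₀ σ).indicator Ψ) 6 volume := by
    refine ENNReal.le_two_mul_of_le_half_add hΔw_fin (hT.trans ?_)
    gcongr ?_ + _
    calc ENNReal.ofReal ε * ∑ k, ∑ l, eLpNorm (fun y ↦ D2w y k l) 6 volume
        ≤ ENNReal.ofReal ε * ∑ _k : Fin 3, ∑ _l : Fin 3, (A : ℝ≥0∞) * eLpNorm (Δ w) 6 volume := by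
          gcongr with k _ l _
          exact hCZ k l
      _ = ENNReal.ofReal (ε * (9 * A)) * eLpNorm (Δ w) 6 volume := by
          simp only [Finset.sum_const, Finset.card_univ, Fintype.card_fin, nsmul_eq_mul,
            Nat.cast_ofNat]
          rw [ENNReal.ofReal_mul hε0, show ((9 : ℝ) * A) = ((9 * A : ℝ≥0) : ℝ) by push_cast; ring,
            ENNReal.ofReal_coe_nnreal]
          push_cast
          ring
      _ ≤ ENNReal.ofReal (1 / 2) * eLpNorm (Δ w) 6 volume := by
          have h1 : ε * (9 * A) ≤ ε₁ * (9 * A) := mul_le_mul_of_nonneg_right hε (by positivity)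
          have h2 : ε₁ * (9 * A) ≤ 1 / 2 := by
            rw [hε₁, div_mul_eq_mul_div, one_mul, div_le_iff₀ (by positivity)]
            nlinarith
          exact mul_le_mul' (ENNReal.ofReal_le_ofReal (h1.trans h2)) le_rfl
      _ = eLpNorm (Δ w) 6 volume / 2 := by
          rw [one_div, ENNReal.ofReal_inv_of_pos two_pos, ENNReal.ofReal_ofNat,
            ENNReal.div_eq_inv_mul]
  -- `‖1_B Ψ‖₆` through the data
  set S₁ : ℝ≥0∞ := ∑ l, eLpNorm (fun y ↦ D1v y l) 6 μ with hS₁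
  set S₀ : ℝ≥0∞ := eLpNorm v 6 μ with hS₀
  set SG : ℝ≥0∞ := eLpNorm G 6 μ with hSG
  have hΨ_bd : eLpNorm ((closedBall x₀ σ).indicator Ψ) 6 volume ≤
      ENNReal.ofReal (L + 8 * (M / σ)) * S₁ + ENNReal.ofReal (L ^ 2 + 12 * (M / σ) ^ 2) * S₀ + SG := by
    rw [eLpNorm_indicator_eq_eLpNorm_restrict measurableSet_closedBall, ← hμ]
    have hm1 : ∀ k, AEStronglyMeasurable (fun y ↦ |D1v y k|) μ := fun k ↦
      (continuous_abs.comp_continuousOn (hD1vc k)).aestronglyMeasurable measurableSet_closedBall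
    have hmA : AEStronglyMeasurable (fun y ↦ (L + 8 * (M / σ)) * ∑ k, |D1v y k|) μ :=
      (Finset.aestronglyMeasurable_fun_sum _ fun k _ ↦ hm1 k).const_mul _
    have hmB : AEStronglyMeasurable (fun y ↦ (L ^ 2 + 12 * (M / σ) ^ 2) * |v y|) μ :=
      ((continuous_abs.comp_continuousOn hvc).aestronglyMeasurable measurableSet_closedBall).const_mul _
    have hmG : AEStronglyMeasurable (fun y ↦ |G y|) μ :=
      (continuous_abs.comp_continuousOn hG).aestronglyMeasurable measurableSet_closedBall
    have hL8 : 0 ≤ L + 8 * (M / σ) := by positivity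
    have hL12 : 0 ≤ L ^ 2 + 12 * (M / σ) ^ 2 := by positivity
    calc eLpNorm Ψ 6 μ
        = eLpNorm ((fun y ↦ (L + 8 * (M / σ)) * ∑ k, |D1v y k|) +
            (fun y ↦ (L ^ 2 + 12 * (M / σ) ^ 2) * |v y|) + fun y ↦ |G y|) 6 μ := by rfl
      _ ≤ eLpNorm ((fun y ↦ (L + 8 * (M / σ)) * ∑ k, |D1v y k|) +
            (fun y ↦ (L ^ 2 + 12 * (M / σ) ^ 2) * |v y|)) 6 μ + eLpNorm (fun y ↦ |G y|) 6 μ :=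
          eLpNorm_add_le (hmA.add hmB) hmG (by norm_num)
      _ ≤ eLpNorm (fun y ↦ (L + 8 * (M / σ)) * ∑ k, |D1v y k|) 6 μ +
            eLpNorm (fun y ↦ (L ^ 2 + 12 * (M / σ) ^ 2) * |v y|) 6 μ + eLpNorm (fun y ↦ |G y|) 6 μ := by
          gcongr
          exact eLpNorm_add_le hmA hmB (by norm_num)
      _ ≤ ENNReal.ofReal (L + 8 * (M / σ)) * S₁ + ENNReal.ofReal (L ^ 2 + 12 * (M / σ) ^ 2) * S₀ + SG := by
          have i1 : eLpNorm (fun y ↦ (L + 8 * (M / σ)) * ∑ k, |D1v y k|) 6 μ ≤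
              ENNReal.ofReal (L + 8 * (M / σ)) * S₁ := by
            rw [show (fun y ↦ (L + 8 * (M / σ)) * ∑ k, |D1v y k|) =
                (L + 8 * (M / σ)) • fun y ↦ ∑ k, |D1v y k| from rfl, eLpNorm_const_smul,
              Real.enorm_eq_ofReal hL8, hS₁]
            refine mul_le_mul' le_rfl ?_
            have hfun : (fun y ↦ ∑ k, |D1v y k|) = ∑ k, fun y ↦ |D1v y k| := by
              funext y; simp only [Finset.sum_apply]
            calc eLpNorm (fun y ↦ ∑ k, |D1v y k|) 6 μ = eLpNorm (∑ k, fun y ↦ |D1v y k|) 6 μ := by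
                  rw [hfun]
              _ ≤ ∑ k, eLpNorm (fun y ↦ |D1v y k|) 6 μ := eLpNorm_sum_le (fun k _ ↦ hm1 k) (by norm_num)
              _ = ∑ k, eLpNorm (fun y ↦ D1v y k) 6 μ := Finset.sum_congr rfl fun k _ ↦
                  eLpNorm_congr_norm_ae (ae_of_all _ fun y ↦ by simp)
          have i2 : eLpNorm (fun y ↦ (L ^ 2 + 12 * (M / σ) ^ 2) * |v y|) 6 μ ≤
              ENNReal.ofReal (L ^ 2 + 12 * (M / σ) ^ 2) * S₀ := by
            rw [show (fun y ↦ (L ^ 2 + 12 * (M / σ) ^ 2) * |v y|) =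
                (L ^ 2 + 12 * (M / σ) ^ 2) • fun y ↦ |v y| from rfl, eLpNorm_const_smul,
              Real.enorm_eq_ofReal hL12, hS₀]
            exact mul_le_mul' le_rfl (eLpNorm_congr_norm_ae (ae_of_all _ fun y ↦ by simp)).le
          have i3 : eLpNorm (fun y ↦ |G y|) 6 μ ≤ SG := by
            rw [hSG]
            exact (eLpNorm_congr_norm_ae (ae_of_all _ fun y ↦ by simp)).le
          exact add_le_add (add_le_add i1 i2) i3
  /- ───── Morrey for `h = ∂ⱼ w` ───── -/
  set h : E3 → ℝ := fun y ↦ fderiv ℝ w y (b j) with hh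
  have hhs : ContDiff ℝ ∞ h := contDiff_fderiv_apply_of_contDiff hws (b j)
  have hh1 : ContDiff ℝ 1 h := hhs.of_le (by norm_cast)
  -- the comparison point
  set y₀ : E3 := x₀ + (2 * σ) • b 0 with hy₀
  have hy₀d : dist y₀ x₀ = 2 * σ := by
    rw [hy₀, dist_eq_norm, add_sub_cancel_left, norm_smul, b.orthonormal.1 0, mul_one,
      Real.norm_eq_abs, abs_of_pos (by positivity)]
  have hy₀out : y₀ ∉ closedBall x₀ σ := by
    rw [mem_closedBall, hy₀d]; linarith
  have hhy₀ : h y₀ = 0 := (hoff y₀ hy₀out).1 j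
  -- `h x = ∂ⱼ v x`
  have hxv : w =ᶠ[𝓝 x] v := by
    have hxball : ball x (σ / 4) ⊆ closedBall x₀ (σ / 2) := by
      intro y hy
      rw [mem_closedBall]
      rw [mem_ball] at hy
      rw [mem_closedBall] at hx
      linarith [dist_triangle y x x₀]
    filter_upwards [ball_mem_nhds x (by positivity : (0 : ℝ) < σ / 4)] with y hy
    show η y • v y = v y
    rw [hη1 y (hxball hy), one_smul]
  have hhx : h x = fderiv ℝ v x (b j) := by
    show fderiv ℝ w x (b j) = fderiv ℝ v x (b j)
    rw [hxv.fderiv_eq]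
  -- Morrey's Hölder estimate between `x` and `y₀`
  have hM1 := hMor hh1 x y₀
  rw [hhy₀, sub_zero, hhx] at hM1
  -- the distance factor
  have hdist : edist x y₀ ^ (1 / 2 : ℝ) ≤ ENNReal.ofReal (Real.sqrt 3 * Real.sqrt σ) := by
    have hd : dist x y₀ ≤ 3 * σ := by
      rw [mem_closedBall] at hx
      have := dist_triangle x x₀ y₀
      rw [dist_comm x₀ y₀, hy₀d] at this
      linarith
    calc edist x y₀ ^ (1 / 2 : ℝ) = ENNReal.ofReal (dist x y₀) ^ (1 / 2 : ℝ) := by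
          rw [edist_dist]
      _ ≤ ENNReal.ofReal (3 * σ) ^ (1 / 2 : ℝ) := by
          gcongr
      _ = ENNReal.ofReal (Real.sqrt 3 * Real.sqrt σ) := by
          rw [ENNReal.ofReal_rpow_of_nonneg (by positivity) (by norm_num), ← Real.sqrt_eq_rpow,
            Real.sqrt_mul (by norm_num)]
  -- the gradient of `h` in `L⁶`
  have hDh : eLpNorm (fderiv ℝ h) 6 volume ≤ (3 * A) * eLpNorm (Δ w) 6 volume := by
    have hpt : ∀ y, ‖fderiv ℝ h y‖ ≤ ‖(∑ i, fun y ↦ |D2w y j i|) y‖ := by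
      intro y
      rw [Finset.sum_apply, Real.norm_eq_abs,
        abs_of_nonneg (Finset.sum_nonneg fun i _ ↦ abs_nonneg _)]
      exact opNorm_le_sum_abs_apply b (fderiv ℝ h y)
    have hm : ∀ i, AEStronglyMeasurable (fun y ↦ |D2w y j i|) volume := fun i ↦
      (continuous_abs.comp (hD2wc j i)).aestronglyMeasurable
    calc eLpNorm (fderiv ℝ h) 6 volume ≤ eLpNorm (∑ i, fun y ↦ |D2w y j i|) 6 volume :=
          eLpNorm_mono hpt
      _ ≤ ∑ i, eLpNorm (fun y ↦ |D2w y j i|) 6 volume := eLpNorm_sum_le (fun i _ ↦ hm i) (by norm_num)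
      _ = ∑ i, eLpNorm (fun y ↦ D2w y j i) 6 volume := Finset.sum_congr rfl fun i _ ↦
          eLpNorm_congr_norm_ae (ae_of_all _ fun y ↦ by simp)
      _ ≤ ∑ _i : Fin 3, (A : ℝ≥0∞) * eLpNorm (Δ w) 6 volume := Finset.sum_le_sum fun i _ ↦ hCZ j i
      _ = (3 * A) * eLpNorm (Δ w) 6 volume := by
          simp only [Finset.sum_const, Finset.card_univ, Fintype.card_fin, nsmul_eq_mul, Nat.cast_ofNat]
          ring
  /- ───── assembly ───── -/
  have hCM : CM = ENNReal.ofReal CM.toReal := (ENNReal.ofReal_toReal hCMtop.ne).symm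
  have hAe : (A : ℝ≥0∞) = ENNReal.ofReal (A : ℝ) := (ENNReal.ofReal_coe_nnreal).symm
  have hM2 : (1 : ℝ) ≤ 12 * M ^ 2 := by nlinarith
  have hσi : 0 ≤ σ⁻¹ := inv_nonneg.2 hσ.le
  have hcoef1 : ENNReal.ofReal (L + 8 * (M / σ)) ≤ ENNReal.ofReal (12 * M ^ 2) * ENNReal.ofReal (L + σ⁻¹) := by
    rw [← ENNReal.ofReal_mul (by positivity)]
    refine ENNReal.ofReal_le_ofReal ?_
    rw [div_eq_mul_inv]
    nlinarith [mul_nonneg hM0 hσi, mul_nonneg hL (by positivity : (0:ℝ) ≤ 12 * M ^ 2 - 1),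
      mul_nonneg (mul_nonneg hM0 hσi) (by nlinarith : (0:ℝ) ≤ 12 * M - 8)]
  have hcoef2 : ENNReal.ofReal (L ^ 2 + 12 * (M / σ) ^ 2) ≤
      ENNReal.ofReal (12 * M ^ 2) * ENNReal.ofReal (L ^ 2 + σ⁻¹ ^ 2) := by
    rw [← ENNReal.ofReal_mul (by positivity)]
    refine ENNReal.ofReal_le_ofReal ?_
    rw [div_eq_mul_inv, mul_pow]
    nlinarith [mul_nonneg (sq_nonneg L) (by positivity : (0:ℝ) ≤ 12 * M ^ 2 - 1)]
  have hcoef3 : SG ≤ ENNReal.ofReal (12 * M ^ 2) * SG := by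
    calc SG = 1 * SG := (one_mul _).symm
      _ ≤ ENNReal.ofReal (12 * M ^ 2) * SG := by
          gcongr
          rw [← ENNReal.ofReal_one]
          exact ENNReal.ofReal_le_ofReal hM2
  calc ‖fderiv ℝ v x (b j)‖ₑ
      ≤ CM * eLpNorm (fderiv ℝ h) 6 volume * edist x y₀ ^ (1 / 2 : ℝ) := hM1
    _ ≤ CM * ((3 * A) * eLpNorm (Δ w) 6 volume) * ENNReal.ofReal (Real.sqrt 3 * Real.sqrt σ) := by
        gcongr
    _ ≤ CM * ((3 * A) * (2 * eLpNorm ((closedBall x₀ σ).indicator Ψ) 6 volume)) *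
          ENNReal.ofReal (Real.sqrt 3 * Real.sqrt σ) := by
        gcongr
    _ ≤ CM * ((3 * A) * (2 * (ENNReal.ofReal (L + 8 * (M / σ)) * S₁ +
          ENNReal.ofReal (L ^ 2 + 12 * (M / σ) ^ 2) * S₀ + SG))) *
          ENNReal.ofReal (Real.sqrt 3 * Real.sqrt σ) := by
        gcongr
    _ ≤ CM * ((3 * A) * (2 * (ENNReal.ofReal (12 * M ^ 2) * ENNReal.ofReal (L + σ⁻¹) * S₁ +
          ENNReal.ofReal (12 * M ^ 2) * ENNReal.ofReal (L ^ 2 + σ⁻¹ ^ 2) * S₀ +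
          ENNReal.ofReal (12 * M ^ 2) * SG))) *
          ENNReal.ofReal (Real.sqrt 3 * Real.sqrt σ) := by
        gcongr
    _ = ENNReal.ofReal (C * Real.sqrt σ) *
          (ENNReal.ofReal (L + σ⁻¹) * S₁ + ENNReal.ofReal (L ^ 2 + σ⁻¹ ^ 2) * S₀ + SG) := by
        rw [hCM, hAe, hC]
        have e1 : ENNReal.ofReal (CM.toReal * Real.sqrt 3 * (6 * A) * (12 * M ^ 2) * Real.sqrt σ) =
            ENNReal.ofReal CM.toReal * (3 * ENNReal.ofReal (A : ℝ)) * 2 *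
              ENNReal.ofReal (12 * M ^ 2) * ENNReal.ofReal (Real.sqrt 3 * Real.sqrt σ) := by
          rw [show CM.toReal * Real.sqrt 3 * (6 * A) * (12 * M ^ 2) * Real.sqrt σ =
              CM.toReal * (3 * A) * 2 * (12 * M ^ 2) * (Real.sqrt 3 * Real.sqrt σ) by ring,
            ENNReal.ofReal_mul (by positivity), ENNReal.ofReal_mul (by positivity),
            ENNReal.ofReal_mul (by positivity), ENNReal.ofReal_mul ENNReal.toReal_nonneg,
            ENNReal.ofReal_mul (by norm_num), ENNReal.ofReal_ofNat, ENNReal.ofReal_ofNat]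
        rw [e1]
        ring

end Main



end Literature.Analysis.PDE
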